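import Summits.ABC.ABC.Theses.IsogenyGlueCongruence
import Literature.NumberTheory.EllipticCurves.SzpiroFreyProofs
import Literature.NumberTheory.EllipticCurves.SzpiroFreyCurveProofs
import Literature.NumberTheory.EllipticCurves.SzpiroOfAbcProofs
import Literature.NumberTheory.EllipticCurves.DegreeConjectureAbcPrelims
import Literature.NumberTheory.DiophantineGeometry.LocalReductionProofs

/-!
# Stub `stub_polyAbc_of_polySzpiroDelta` of line `Sketch` (card `archimedean-hall-split`) for crux
stmt-ABC-16006 `PolyHeightOfBoundedPrimes`: the finite half alone is abc-strength

Calibration (position) stub of the finite / archimedean split of the polynomial height conjecture `H`.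
The finite half `PolySzpiroΔ` — `|Δ_W| ≤ C · N_W^σ` for every semistable globally minimal elliptic
`W/ℚ` — ALONE already yields polynomial abc on Serre-normalised triples: for coprime `A, B` with
`AB(A+B) ≠ 0`, `A ≡ −1 (mod 4)`, `32 ∣ B`, one gets `(AB(A+B))² ≤ 2⁸ · max(C,0) · N^σ`, `N` the
conductor of the Frey curve `freyCurve A B`. Proof: apply the hypothesis to the global minimal model
`freyIntModel₂ A B ⊗ ℚ` (Bombieri–Gubler (12.18); minimal by `isMinimalAt_freyIntModel₂`, isomorphic to
the Frey curve by `smul_freyCurve_eq_baseChange_freyIntModel₂`, hence semistable with the Frey curve's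
conductor), whose discriminant is `(AB/16)²(A+B)²` (`freyIntModel₂_Δ`). This is the `Δ`-only variant of
`Summit.ABC.ABC.Theorems.polyAbcNormalized_of_polyHeight` (which uses only the `Δ`-component of `H`).
Supports stmt-ABC-16006; registered stub `stub_polyAbc_of_polySzpiroDelta` verbatim, plus the curried
corollary `polyAbcNormalized_of_polySzpiroDelta` with the explicit constants `(σ, 2⁸ · max(C,0))`.
-/

noncomputable section

-- single-conjunct summit ABC: the duplicate ABC.ABC is mandated (CONVENTIONS §2)
set_option linter.dupNamespace false

namespace Summit.ABC.ABC.Theorems.PolyHeightOfBoundedPrimes.HallSplit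

open IsDedekindDomain WeierstrassCurve
open Literature.NumberTheory.DiophantineGeometry Literature.NumberTheory.EllipticCurves
open Summit.ABC.ABC.Theses.IsogenyGlueCongruence

/-- **`PolySzpiroΔ` with constants `(σ, C)` ⟹ polynomial abc on Serre-normalised triples with constants
`(σ, 2⁸·max(C,0))`.** If `|Δ_W| ≤ C·N_W^σ` for every semistable globally minimal elliptic `W/ℚ`, then
`(AB(A+B))² ≤ 2⁸·max(C,0)·N^σ` for all coprime `A, B` with `AB(A+B) ≠ 0`, `A ≡ −1 (mod 4)`, `32 ∣ B`,
where `N` is the conductor of the Frey curve `freyCurve A B`. Proof: apply the hypothesis to the global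
minimal model `freyIntModel₂ A B ⊗ ℚ` (minimal: `isMinimalAt_freyIntModel₂`; semistable and of the same
conductor as the Frey curve: `isSemistable_freyCurve_of_mod_holds`, `isSemistable_smul_iff_holds`,
`conductorNorm_smul_rat`), whose discriminant is `(AB/16)²(A+B)²` (`freyIntModel₂_Δ`), and note
`(AB(A+B))² = 2⁸ · (AB/16)²(A+B)²`. [cite: BombieriGubler2006, Ex. 12.5.10] -/
theorem polyAbcNormalized_of_polySzpiroDelta {σ C : ℝ}
    (hH : ∀ (W : WeierstrassCurve ℚ) [W.IsElliptic] [W.IsGloballyMinimal]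
      [NeZero (W.conductorNorm ℤ)], W.IsSemistable ℤ →
        ((|W.Δ| : ℚ) : ℝ) ≤ C * (W.conductorNorm ℤ : ℝ) ^ σ)
    {A B : ℤ} (hAB : IsCoprime A B) (h0 : A * B * (A + B) ≠ 0) (hA : A ≡ -1 [ZMOD 4])
    (hB : (32 : ℤ) ∣ B) :
    (((A * B * (A + B)) ^ 2 : ℤ) : ℝ) ≤
      256 * max C 0 * ((freyCurve A B).conductorNorm ℤ : ℝ) ^ σ := by
  -- Serre's normalisation, in the divisibility forms the tree lemmas take
  have hA4 : 4 ∣ A + 1 := by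
    have h := Int.modEq_iff_dvd.mp hA
    have : A + 1 = -(-1 - A) := by ring
    rw [this]; exact (dvd_neg).mpr h
  have hB16 : (16 : ℤ) ∣ B := dvd_trans (by norm_num) hB
  have h4 : 4 ∣ B - A - 1 := by
    have : B - A - 1 = B - (A + 1) := by ring
    rw [this]; exact dvd_sub (dvd_trans (by norm_num) hB16) hA4
  have h16' : 16 ∣ A * B := dvd_mul_of_dvd_right hB16 _
  haveI := isElliptic_freyCurve h0
  haveI := isElliptic_freyIntModel₂ h0 h4 h16'
  haveI : ((freyIntModel₂ A B).baseChange ℚ).IsGloballyMinimal :=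
    isGloballyMinimal_of_forall_isMinimalAt_int _ (isMinimalAt_freyIntModel₂ hAB hA4 hB16)
  -- the minimal model has the conductor of the Frey curve and is semistable
  have hCW := smul_freyCurve_eq_baseChange_freyIntModel₂ h4 h16'
  have hcond : ((freyIntModel₂ A B).baseChange ℚ).conductorNorm ℤ =
      (freyCurve A B).conductorNorm ℤ := by
    rw [← hCW, WeierstrassCurve.conductorNorm_smul_rat]
  haveI : NeZero (((freyIntModel₂ A B).baseChange ℚ).conductorNorm ℤ) :=
    ⟨(conductorNorm_pos_holds _).ne'⟩
  have hss : ((freyIntModel₂ A B).baseChange ℚ).IsSemistable ℤ := by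
    rw [← hCW]
    exact (WeierstrassCurve.isSemistable_smul_iff_holds ℤ (freyCurve A B) _).mpr
      (isSemistable_freyCurve_of_mod_holds A B hAB h0 hA hB)
  -- apply the hypothesis `PolySzpiroΔ`
  have hmain := hH ((freyIntModel₂ A B).baseChange ℚ) hss
  rw [hcond] at hmain
  -- the discriminant of the minimal model
  obtain ⟨w, hw⟩ := h16'
  have hw' : A * B / 16 = w := by rw [hw]; simp
  have hΔq : ((freyIntModel₂ A B).baseChange ℚ).Δ = (((freyIntModel₂ A B).Δ : ℤ) : ℚ) := by
    simp [WeierstrassCurve.baseChange, WeierstrassCurve.map_Δ]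
  have hΔeq : (freyIntModel₂ A B).Δ = w ^ 2 * (A + B) ^ 2 := by
    rw [freyIntModel₂_Δ h4 ⟨w, hw⟩, hw']
  have hsq : (A * B * (A + B)) ^ 2 = 256 * (w ^ 2 * (A + B) ^ 2) := by rw [hw]; ring
  -- `w²(A+B)² = |Δ| ≤ C N^σ ≤ max C 0 · N^σ`
  have hN0 : (0 : ℝ) ≤ ((freyCurve A B).conductorNorm ℤ : ℝ) ^ σ := by positivity
  have h1 : ((w ^ 2 * (A + B) ^ 2 : ℤ) : ℝ) ≤ max C 0 * ((freyCurve A B).conductorNorm ℤ : ℝ) ^ σ := by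
    have habs : |((freyIntModel₂ A B).baseChange ℚ).Δ| = ((w ^ 2 * (A + B) ^ 2 : ℤ) : ℚ) := by
      rw [hΔq, hΔeq, abs_of_nonneg]
      positivity
    have e2 : (((w ^ 2 * (A + B) ^ 2 : ℤ) : ℚ) : ℝ) = ((w ^ 2 * (A + B) ^ 2 : ℤ) : ℝ) := by
      push_cast; ring
    rw [← e2, ← habs]
    exact hmain.trans (mul_le_mul_of_nonneg_right (le_max_left _ _) hN0)
  calc (((A * B * (A + B)) ^ 2 : ℤ) : ℝ) = 256 * ((w ^ 2 * (A + B) ^ 2 : ℤ) : ℝ) := by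
        rw [hsq]; push_cast; ring
    _ ≤ 256 * (max C 0 * ((freyCurve A B).conductorNorm ℤ : ℝ) ^ σ) :=
        mul_le_mul_of_nonneg_left h1 (by norm_num)
    _ = 256 * max C 0 * ((freyCurve A B).conductorNorm ℤ : ℝ) ^ σ := by ring

/-- **Registered calibration stub `stub_polyAbc_of_polySzpiroDelta` (position of the finite half).**
The finite half `PolySzpiroΔ` of the split of `H` — `|Δ_W| ≤ C·N_W^σ` on semistable global minimal
models — ALONE implies polynomial abc on Serre-normalised triples: `(AB(A+B))² ≤ C'·N^σ` for coprime
`A, B` with `AB(A+B) ≠ 0`, `A ≡ −1 (mod 4)`, `32 ∣ B`, `N` the conductor of `freyCurve A B`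
(`C' = 2⁸·max(C,0)`, `polyAbcNormalized_of_polySzpiroDelta`); so the finite half is abc-strength.
[cite: BombieriGubler2006, Ex. 12.5.10] -/
theorem stub_polyAbc_of_polySzpiroDelta :
    (∃ σ C : ℝ, ∀ (W : WeierstrassCurve ℚ) [W.IsElliptic] [W.IsGloballyMinimal]
      [NeZero (W.conductorNorm ℤ)], W.IsSemistable ℤ →
        ((|W.Δ| : ℚ) : ℝ) ≤ C * (W.conductorNorm ℤ : ℝ) ^ σ) →
    ∃ σ C : ℝ, ∀ A B : ℤ, IsCoprime A B → A * B * (A + B) ≠ 0 → A ≡ -1 [ZMOD 4] → (32 : ℤ) ∣ B →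
      (((A * B * (A + B)) ^ 2 : ℤ) : ℝ) ≤ C * ((freyCurve A B).conductorNorm ℤ : ℝ) ^ σ := by
  rintro ⟨σ, C, hH⟩
  exact ⟨σ, 256 * max C 0, fun A B hAB h0 hA hB ↦
    polyAbcNormalized_of_polySzpiroDelta (fun W _ _ _ hW ↦ hH W hW) hAB h0 hA hB⟩

end Summit.ABC.ABC.Theorems.PolyHeightOfBoundedPrimes.HallSplit

end
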